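import Literature.AnabelianGeometry.EtaleTheta.ArithThetaTowerFrobenioid
import Literature.AnabelianGeometry.EtaleTheta.ArithThetaTowerRealifiedOf
import Literature.AnabelianGeometry.EtaleTheta.TemperedFrobenioidOfGenDiagonalBase
import Literature.AnabelianGeometry.EtaleTheta.Discharge.Sec3BLambdaInjectiveOfGaloisCoveringConnected
import Literature.AlgebraicGeometry.Frobenioids.PadicFrobenioidZeroMonoid
import Literature.AnabelianGeometry.SemiGraphs.CosetCategoriesFSM
import HarnessLib

/-!
# [IUTchI] Ex. 3.2 (i) / [EtTh] Def. 3.6 (ii) at the ARITHMETIC theta tower over `𝒟_v̲ = CosetCat Π_v̲`: the FIVE LAWS of the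
# carrier, ENGINE FORM (GAP A item GA-12, LAW half of D4 — file 1 of 3)

S. Mochizuki, *The étale theta function …*, Publ. RIMS **45** (2009) [MochizukiEtTh2009], Def. 3.3 (iii) / Rmk. 3.3.1 p.73, Def. 3.6
(i)(ii) pp.76–77 (PDF) [cite: MochizukiEtTh2009, Def 3.6 p.77]; *Inter-universal Teichmüller Theory I* [Mochizuki2012], Ex. 3.2 (i)
p.70 [claim: Mochizuki2012, status: disputed — nothing of the series is asserted]; [FrdI] Def. 1.1 (i)(ii) p.19; [FrdII] Ex. 1.1 (i) p.7.

GAP A of record G-L5-EX32I-1 (abc-iut cell; the UNDISPUTED construction around [IUTchIII] Cor. 3.12), item **GA-12** (GAP-SIZING-A.md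
69de97346848d3e8 §2 row D4 LAW half; `plan/L5/GAP-A-SIGNATURES.md` v1 e3ccddf9b87597cf §0/§4 «GA-04b (prover)»; RULINGS #317 (2) / #319 /
#321/#322 (c2′)(c3′) / #334 (2) / #339), seat abc-iut-gapA-12-def36iiLawsCarrierSpec (abc-iut-L2-t1 class).  Binders §0: `{p} [Fact p.Prime]
(d : GaloisValDatum.{0} p) {P : Type} [Group P] [TopologicalSpace P] (T : BadLocalGroupDatum d.Gal P)`.  CONSUMED BY NAME: GA-04's TYPE
(`CarrierData.canonical` / `CarrierData.toTemperedFrobenioid (h₁…h₅)` / `catVocab`, ★ p667989), GA-02's engine `divisorMonoidsOf d T A hZ`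
(`Φ₀(U) = ord(𝒪^▷_{Ω^{aug U}}) × Div⁺(Z)^U`, ★ p667325), GA-03's `realifiedOf d T A hZ = ofRlfZWeak (divisorMonoidsOf d T A hZ) _` (★ p668558),
abc-iut-L2-t3's generic Def. 3.6 (ii) ENGINE `TemperedFrobenioid.ofGenDiagonalBase` (every clause proved for `Φ := im(Φ₀^pf → Φ₀^rlf)`).

WHAT IS HERE — ENGINE FORM of the LAW half, for the constant datum `d`, the kit's `T` and ANY geometric log-divisor model `Z` with `Π`-action
`A` and trivial constants (`hZc : Z.const = ⊥`: in the direct-sum design of RULINGS #334 (2) the GENUINE constants `(Ω^{aug U})ˣ` and their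
special-fibre divisors live in the `ord(𝒪^▷_{Ω^{aug U}})` factor; GA-10's `Envelope.model` has `const = ⊥`):
* §1 coordinates of `Φ₀(U)`: the MULTIPLICITY coordinates `multCoord A S s x` (Def. 3.1 (i), `Z.divPlusEquiv`) and the VALUATION coordinate
  `valEquiv : ord(𝒪^▷_{Ω^{aug U}}) ≅ ℤ≥0` (GA-03's `isZMonoprime_constΦ₀`) with generator `unifCls U` (the class of a uniformiser of `Ω^{aug U}`);
* §2 **`genDiagonalBase d T A hZ hZc : GenDiagonalBase (divisorMonoidsOf d T A hZ) T.Dv`** along `𝟭 𝒟_v̲`: diagonal `d_U := (unifCls U, 1)`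
  («`div ϖ`»), `Φ₀^cnst(U) = ⟨[d_U]⟩`, pull-backs of `Φ₀` injective and divisibility-reflecting (`PadicFrd.ordIntMapOfHom_injective`,
  `phiZeroPull_injective` / `phiZeroPull_reflects_dvd` along `P/U ↠ P/V`);
* §3 **the five laws AT GA-04's CARRIER DATUM** `CarrierData.canonical (realifiedOf d T A hZ)`: `canonical_Φ_eq_Φsub` (GA-04's
  `perfSaturation(im(Φ₀ → Φ₀^ℝ))` IS the engine's `im(Φ₀^pf → Φ₀^rlf)`, `perfSaturation_mrange_toR_ofRlfZWeak`), and transported along it from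
  `ofGenDiagonalBase`: `isGroupSaturated_canonical` (h₁) · `isPerfFactorial_canonical` (h₂) · `isDivisorialOn_canonical` (h₃) ·
  `isMonoprime_bsFld_canonical` (h₄) · `exists_FΛ_div_ne_canonical` (h₅); **`temperedFrobenioidOf d T A hZ hZc : TemperedFrobenioid
  (realifiedOf d T A hZ) T.Dv (catVocab d T) := (CarrierData.canonical (realifiedOf d T A hZ)).toTemperedFrobenioid h₁ h₂ h₃ h₄ h₅`** (GA-04
  ★ p667989 l.223 ON THE NOSE) + `temperedFrobenioidOf_bsFld_carrier`: `Φ^{bs-fld}(U) = ι(⟨d_U⟩^pf) ≅ ℚ≥0`, Def. 3.6 (ii)(a) WITH CONTENT.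
The ruled `temperedFrobenioid d T` (file 3, `ArithThetaTowerFrobenioidLaws.lean`) is this engine at GA-10's theta envelope.
INSTANCE NOTE (§6 typer's call «instance assumptions on `P` copied from the slot»): §3 carries `[IsTopologicalGroup P]` — the instance of
the slot's `↥(B x hx).H ≤ D.PiC` (a `ProfiniteGrp`) — since [FrdI] Def. 1.1 (ii)(b) rests on `CosetCat.isOfFSMType`.

carrier: genuine-by-[EtTh]-recipe on the T-lattice (Ÿ_T, Ÿ_T × V, X̲̲_v̲ × V) + constants everywhere; off-lattice Φ via `rebase`/pullback;
[EtTh] Def 3.3 Φ at general U and print's Ÿ̈/μ_N Kummer levels = FOUNDATIONS 13/14, not claimed (RULINGS #322 (c3′); the carrier is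
GA-02/GA-04's).  GUARD (#322): for a `T` that is not a finite level of the theta tower the carrier is print's recipe TRANSPORTED by (n_T, e(V|K_v̲)).
HONEST FRAMING: constructions/theorems over typed interfaces; `(Z, A)` is a parameter; nothing here is asserted to be the tempered Frobenioid
of an actual Tate curve; an UNDISPUTED construction around [IUTchIII] Cor. 3.12, OPEN by charter (D-0045) — no side taken on it or on any
author; NOT an abc claim; typed ≠ inhabited ≠ proved-in-print; count-neutral.  No `Prop` fact, no instance, no notation, no attribute, no `sorry`.
-/

noncomputable section

namespace Literature.AnabelianGeometry.EtaleTheta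

namespace ArithThetaTower

open CategoryTheory Opposite Function Literature.AlgebraicGeometry.Frobenioids
  Literature.AlgebraicGeometry.Frobenioids.PadicFrd Literature.AnabelianGeometry.SemiGraphs Literature.IUT.HodgeTheaters
  LogDivisorModel LogDivisorModel.GaloisAction

variable {p : ℕ} [Fact p.Prime] (d : GaloisValDatum.{0} p) {P : Type} [Group P]

/-! ## §0 Two folklore lemmas -/

/-- Every element of a Grothendieck group is a quotient of two elements of the monoid. [folklore] -/
private theorem exists_eq_of_div_of' {M : Type*} [CommMonoid M] (g : Algebra.GrothendieckGroup M) :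
    ∃ x y : M, g = Algebra.GrothendieckGroup.of x / Algebra.GrothendieckGroup.of y := by
  induction g using Localization.induction_on with
  | H q =>
    refine ⟨q.1, q.2, eq_div_iff_mul_eq'.mpr ?_⟩
    show Localization.mk q.1 q.2 * Localization.mk (q.2 : M) 1 = Localization.mk q.1 1
    rw [Localization.mk_mul, Localization.mk_eq_mk_iff, Localization.r_iff_exists]
    exact ⟨1, by simp [mul_comm]⟩

/-- Divisibility in `ℤ≥0` (multiplicative notation) is the order. [folklore] -/
private theorem mnat_dvd_iff (x y : Multiplicative ℕ) : x ∣ y ↔ Multiplicative.toAdd x ≤ Multiplicative.toAdd y := by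
  constructor
  · rintro ⟨c, rfl⟩
    rw [toAdd_mul]
    exact Nat.le_add_right _ _
  · intro h
    refine ⟨Multiplicative.ofAdd (Multiplicative.toAdd y - Multiplicative.toAdd x), ?_⟩
    apply Multiplicative.toAdd.injective
    rw [toAdd_mul, toAdd_ofAdd, Nat.add_sub_cancel' h]

/-- An injective homomorphism between `ℤ`-monoprime monoids (`≅ ℤ≥0`) reflects divisibility: divisibility is total on both sides
and mutual divisibility forces equality. [cite: MochizukiFrdI2008, §0 p.10] -/
theorem dvd_of_map_dvd_of_isZMonoprime {M N : Type*} [CommMonoid M] [CommMonoid N] (hM : IsZMonoprime M)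
    (hN : IsZMonoprime N) (f : M →* N) (hf : Injective f) {a b : M} (h : f a ∣ f b) : a ∣ b := by
  obtain ⟨e⟩ := hM.nonempty_mulEquiv
  obtain ⟨e'⟩ := hN.nonempty_mulEquiv
  rcases le_total (Multiplicative.toAdd (e a)) (Multiplicative.toAdd (e b)) with hab | hba
  · have h1 : e a ∣ e b := (mnat_dvd_iff _ _).mpr hab
    simpa only [MulEquiv.symm_apply_apply] using map_dvd e.symm h1
  · have h1 : b ∣ a := by
      simpa only [MulEquiv.symm_apply_apply] using map_dvd e.symm ((mnat_dvd_iff _ _).mpr hba)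
    have h2 : e' (f b) ∣ e' (f a) := map_dvd e' (map_dvd f h1)
    have h3 : e' (f a) ∣ e' (f b) := map_dvd e' h
    have h4 : e' (f a) = e' (f b) :=
      Multiplicative.toAdd.injective (le_antisymm ((mnat_dvd_iff _ _).mp h3) ((mnat_dvd_iff _ _).mp h2))
    rw [hf (e'.injective h4)]

/-! ## §1a Multiplicity coordinates of `Φ₀^geom(S) = Hom_Π(S, Div⁺(Z))` -/

section MultCoord

variable {Z : LogDivisorModel.{0}} (A : Z.GaloisAction P) (S : Action (Type 0) P)

/-- The value `φ(s) ∈ DIV⁺(Z)` of a `Π`-invariant effective Cartier divisor `φ ∈ Φ₀^geom(S) = Hom_Π(S, Div⁺(Z))` at the point `s`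
(a monoid homomorphism). [cite: MochizukiEtTh2009, Def 3.3 p.73] -/
def evalDIVplus (s : S.V) : A.phiZero S →* Z.DIVplus where
  toFun φ := ⟨φ.1 s, Z.Divplus_le_DIVplus (φ.2.1 s)⟩
  map_one' := rfl
  map_mul' _ _ := rfl

/-- **The multiplicity coordinate** `multCoord A S s x : Φ₀^geom(S) → ℤ≥0` — the multiplicity of `φ(s)` at the prime log-divisor
`x ∈ Cusp ⊔ Comp` (Def. 3.1 (i): `DIV⁺ ≅ ∏_{cusps ⊔ components} ℤ≥0`, `Z.divPlusEquiv`; Rmk. 3.3.1).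
[cite: MochizukiEtTh2009, Def 3.1 p.70] -/
def multCoord (s : S.V) (x : Z.Idx) : A.phiZero S →* Multiplicative ℕ :=
  ((Pi.evalMonoidHom (fun _ : Z.Idx => Multiplicative ℕ) x).comp Z.divPlusEquiv.toMonoidHom).comp (evalDIVplus A S s)

/-- **The multiplicity coordinates are jointly injective** (an effective log-divisor is determined by its multiplicities, a
`Π`-invariant divisor-valued map by its values). [cite: MochizukiEtTh2009, Def 3.1 p.70] -/
theorem multCoord_separating {φ ψ : A.phiZero S} (h : ∀ (s : S.V) (x : Z.Idx), multCoord A S s x φ = multCoord A S s x ψ) :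
    φ = ψ := by
  refine Subtype.ext (funext fun s => ?_)
  have hs : evalDIVplus A S s φ = evalDIVplus A S s ψ :=
    Z.divPlusEquiv.injective (funext fun x => h s x)
  exact congrArg Subtype.val hs

/-- An element all of whose multiplicity coordinates vanish is trivial. [cite: MochizukiEtTh2009, Def 3.1 p.70] -/
theorem eq_one_of_multCoord_eq_one {φ : A.phiZero S} (h : ∀ (s : S.V) (x : Z.Idx), multCoord A S s x φ = 1) : φ = 1 :=
  multCoord_separating A S fun s x => by rw [h s x, map_one]

end MultCoord

variable [TopologicalSpace P] (T : BadLocalGroupDatum d.Gal P)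

/-! ## §1b The valuation coordinate of `Φ₀(U) = ord(𝒪^▷_{Ω^{aug U}}) × Div⁺(Z)^U` -/

/-- **The valuation coordinate**: `ord(𝒪^▷_{Ω^{aug U}}) ≅ ℤ≥0` — the constant field `Ω^{aug U}` of the covering `U` is a `p`-adic
LOCAL field (GA-03's `isZMonoprime_constΦ₀` ⇐ abc-iut-L1's `IsPadicLocal.isZMonoprime_ordInt`); a chosen isomorphism.
[cite: MochizukiFrdII2008, Ex 1.1 (i) p.7] -/
def valEquiv (U : T.Dv) : OrdInt (constFld d T U).K ≃* Multiplicative ℕ :=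
  (isZMonoprime_constΦ₀ d T (op U)).nonempty_mulEquiv.some

/-- **`unifCls U`** — the generator of `ord(𝒪^▷_{Ω^{aug U}}) ≅ ℤ≥0`: the class of a uniformiser of `Ω^{aug U}` (the reduced
special-fibre divisor of a constant). [cite: MochizukiFrdII2008, Ex 1.1 (i) p.7] -/
def unifCls (U : T.Dv) : OrdInt (constFld d T U).K := (valEquiv d T U).symm (Multiplicative.ofAdd 1)

/-- The valuation coordinate of `unifCls U` is `1`. [cite: MochizukiFrdII2008, Ex 1.1 (i) p.7] -/
theorem valEquiv_unifCls (U : T.Dv) : valEquiv d T U (unifCls d T U) = Multiplicative.ofAdd 1 :=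
  MulEquiv.apply_symm_apply _ _

/-- The valuation coordinate of `(unifCls U)^n` is `n`. [cite: MochizukiFrdII2008, Ex 1.1 (i) p.7] -/
theorem valEquiv_unifCls_pow (U : T.Dv) (n : ℕ) : valEquiv d T U (unifCls d T U ^ n) = Multiplicative.ofAdd n := by
  rw [map_pow, valEquiv_unifCls, ← ofAdd_nsmul, smul_eq_mul, mul_one]

/-- `unifCls U ≠ 1`. [cite: MochizukiFrdII2008, Ex 1.1 (i) p.7] -/
theorem unifCls_ne_one (U : T.Dv) : unifCls d T U ≠ 1 := fun h => by
  have h2 := valEquiv_unifCls d T U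
  rw [h, map_one] at h2
  exact one_ne_zero (ofAdd_eq_one.mp h2.symm)

/-- **Every element of `ord(𝒪^▷_{Ω^{aug U}})` is a power of `unifCls U`** (it is `unifCls ^ (its valuation coordinate)`).
[cite: MochizukiFrdII2008, Ex 1.1 (i) p.7] -/
theorem eq_unifCls_pow (U : T.Dv) (a : OrdInt (constFld d T U).K) :
    a = unifCls d T U ^ Multiplicative.toAdd (valEquiv d T U a) :=
  (valEquiv d T U).injective (by rw [valEquiv_unifCls_pow, ofAdd_toAdd])

/-- **Every element of `ord(𝒪^▷_{Ω^{aug U}})^gp ≅ ℤ` is an integral power of `[unifCls U]`.** [cite: MochizukiFrdII2008, Ex 1.1 (i) p.7] -/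
theorem mem_zpowers_of_unifCls (U : T.Dv) (g : Algebra.GrothendieckGroup (OrdInt (constFld d T U).K)) :
    g ∈ Subgroup.zpowers (Algebra.GrothendieckGroup.of (unifCls d T U)) := by
  obtain ⟨x, y, rfl⟩ := exists_eq_of_div_of' g
  rw [eq_unifCls_pow d T U x, eq_unifCls_pow d T U y, map_pow, map_pow]
  exact Subgroup.div_mem _ (Subgroup.npow_mem_zpowers _ _) (Subgroup.npow_mem_zpowers _ _)

/-! ## §2 The pattern diagonal base data of the engine `divisorMonoidsOf d T A hZ` along `𝟭 𝒟_v̲` -/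

section GenDiag

variable {Z : LogDivisorModel.{0}} (A : Z.GaloisAction P) (hZ : Z.CuspLaws)

/-- The coordinates of `Φ₀(U) = ord(𝒪^▷_{Ω^{aug U}}) × Hom_Π(Π/U, Div⁺(Z))`: the valuation coordinate (index `inl`) and the
multiplicity coordinates (index `inr (s, x)`, `s ∈ Π/U`, `x ∈ Cusp ⊔ Comp`). [cite: MochizukiEtTh2009, Rmk 3.3.1 p.73] -/
def coordOf (U : T.Dv) :
    Unit ⊕ (U.carrier × Z.Idx) → (((divisorMonoidsOf d T A hZ).Φ₀.obj (op U) : Type) →* Multiplicative ℕ)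
  | Sum.inl _ => (valEquiv d T U).toMonoidHom.comp (MonoidHom.fst _ _)
  | Sum.inr sx => (multCoord A ((cosetGSetFunctor P).obj U) sx.1 sx.2).comp (MonoidHom.snd _ _)

/-- **The diagonal `d_U := (unifCls U, 1)`** — the reduced special-fibre divisor `div ϖ` of a uniformiser `ϖ` of the constant field
`Ω^{aug U}`, which in the direct-sum design lives in the `ord(𝒪^▷_{Ω^{aug U}})` factor (RULINGS #334 (2)).
[cite: MochizukiEtTh2009, Def 3.3 p.73] -/
def diagOf (U : T.Dv) : ((divisorMonoidsOf d T A hZ).Φ₀.obj (op U) : Type) := (unifCls d T U, 1)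

/-- **The transition maps of `Φ₀` of the engine are injective** (`ord`-restriction along a field homomorphism compatible with
valuations × pull-back along the surjection `P/U ↠ P/V`). [cite: MochizukiEtTh2009, Def 3.3 p.73] -/
theorem divisorMonoidsOf_Φ₀_map_injective {U V : T.Dvᵒᵖ} (f : U ⟶ V) :
    Injective ((divisorMonoidsOf d T A hZ).Φ₀.map f).hom := by
  rintro ⟨a₁, a₂⟩ ⟨b₁, b₂⟩ h
  have h1 := congrArg Prod.fst h
  have h2 := congrArg Prod.snd h
  rw [divisorMonoidsOf_Φ₀_map_apply, divisorMonoidsOf_Φ₀_map_apply] at h1 h2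
  exact Prod.ext (ordIntMapOfHom_injective _ _ h1)
    (A.phiZeroPull_injective _ (cosetGSetFunctor_map_surjective P f.unop) h2)

/-- **The transition maps of `Φ₀` of the engine reflect divisibility** (the valuation factor: an injective map `ℤ≥0 → ℤ≥0`;
the geometric factor: abc-iut-w6-d048's `phiZeroPull_reflects_dvd` along `P/U ↠ P/V`). [cite: MochizukiEtTh2009, Def 3.3 p.73] -/
theorem divisorMonoidsOf_Φ₀_map_reflects_dvd {U V : T.Dvᵒᵖ} (f : U ⟶ V)
    (a b : ((divisorMonoidsOf d T A hZ).Φ₀.obj U : Type))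
    (h : ((divisorMonoidsOf d T A hZ).Φ₀.map f).hom a ∣ ((divisorMonoidsOf d T A hZ).Φ₀.map f).hom b) : a ∣ b := by
  obtain ⟨a₁, a₂⟩ := a
  obtain ⟨b₁, b₂⟩ := b
  have h' : ((ordIntMapOfHom (d.fieldFunctor.map (T.proj.map f.unop)).alg (d.fieldFunctor.map (T.proj.map f.unop)).isValHom a₁,
      A.phiZeroPull ((cosetGSetFunctor P).map f.unop) a₂) :
        OrdInt (constFld d T V.unop).K × A.phiZero ((cosetGSetFunctor P).obj V.unop)) ∣
      (ordIntMapOfHom (d.fieldFunctor.map (T.proj.map f.unop)).alg (d.fieldFunctor.map (T.proj.map f.unop)).isValHom b₁,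
        A.phiZeroPull ((cosetGSetFunctor P).map f.unop) b₂) := h
  obtain ⟨h1, h2⟩ := Prod.mk_dvd_mk.mp h'
  change ((a₁, a₂) : OrdInt (constFld d T U.unop).K × A.phiZero ((cosetGSetFunctor P).obj U.unop)) ∣ (b₁, b₂)
  exact Prod.mk_dvd_mk.mpr
    ⟨dvd_of_map_dvd_of_isZMonoprime (isZMonoprime_constΦ₀ d T U) (isZMonoprime_constΦ₀ d T V) _
        (ordIntMapOfHom_injective _ _) h1,
      A.phiZeroPull_reflects_dvd _ (cosetGSetFunctor_map_surjective P f.unop) _ _ h2⟩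

omit [TopologicalSpace P] in
/-- With trivial geometric constants (`Z.const = ⊥`) the `U`-invariant constant functions of `Z` are trivial.
[cite: MochizukiEtTh2009, Def 3.3 p.73] -/
theorem eq_one_of_mem_fZero (hZc : Z.const = ⊥) (S : Action (Type 0) P) {b : A.bZero S} (hb : b ∈ A.fZero S) : b = 1 := by
  refine Subtype.ext (funext fun s => ?_)
  have hs := (A.mem_fZero_iff S b).mp hb s
  rw [hZc, Subgroup.mem_bot] at hs
  exact hs

/-- **Pattern diagonal base data of the engine `divisorMonoidsOf d T A hZ` along the identity base functor `𝟭 𝒟_v̲`**: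
coordinates = valuation ⊔ multiplicities, distinguished = the valuation coordinate, diagonal `d_U = (unifCls U, 1)` (pattern:
`1` at the valuation coordinate, `0` elsewhere), `Φ₀^cnst(U) = ⟨[d_U]⟩` (constants have divisor `(ord c, 0)`), `[d_U] = div (ϖ_U, 1)`,
pull-backs injective and divisibility-reflecting. [cite: MochizukiEtTh2009, Def 3.6 p.77] -/
def genDiagonalBase (hZc : Z.const = ⊥) : TemperedFrobenioid.GenDiagonalBase (divisorMonoidsOf d T A hZ) T.Dv where
  F := 𝟭 T.Dv
  I U := Unit ⊕ (U.carrier × Z.Idx)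
  i₀ _ := Sum.inl ()
  κ U i := coordOf d T A hZ U i
  d U := diagOf d T A hZ U
  κ_d₀ U := by
    change valEquiv d T U (unifCls d T U) = _
    exact valEquiv_unifCls d T U
  eq_pow_of_κ_eq U m c h := by
    have h0 := h (Sum.inl ())
    change valEquiv d T U m.1 = valEquiv d T U (unifCls d T U) ^ c at h0
    rw [← map_pow] at h0
    have h1 : m.1 = unifCls d T U ^ c := (valEquiv d T U).injective h0
    have h2 : m.2 = 1 := by
      refine eq_one_of_multCoord_eq_one A _ fun s x => ?_
      have hsx := h (Sum.inr (s, x))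
      change multCoord A _ s x m.2 = multCoord A _ s x (1 : A.phiZero _) ^ c at hsx
      rw [hsx, map_one, one_pow]
    change m = (unifCls d T U, (1 : A.phiZero ((cosetGSetFunctor P).obj U))) ^ c
    rw [Prod.pow_mk, one_pow]
    exact Prod.ext h1 h2
  div₀_mem_zpowers U b hb := by
    have hb2 : b.2 = 1 := eq_one_of_mem_fZero A hZc _ hb.2
    have h2 : A.divZeroHom ((cosetGSetFunctor P).obj U) b.2 = 1 := by
      rw [hb2]
      exact map_one _
    obtain ⟨k, hk⟩ := Subgroup.mem_zpowers_iff.mp (mem_zpowers_of_unifCls d T U (divUnits (constFld d T U).K b.1))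
    have key : (divisorMonoidsOf d T A hZ).div₀ (op U) b =
        Algebra.GrothendieckGroup.of
          ((unifCls d T U, 1) : OrdInt (constFld d T U).K × A.phiZero ((cosetGSetFunctor P).obj U)) ^ k := by
      rw [divisorMonoidsOf_div₀_apply]
      dsimp only [Opposite.unop_op]
      rw [h2, map_one, mul_one, ← hk, map_zpow, EtaleTheta.gpMap_of]
      rfl
    change (divisorMonoidsOf d T A hZ).div₀ (op U) b ∈
      Subgroup.zpowers (Algebra.GrothendieckGroup.of
        ((unifCls d T U, 1) : OrdInt (constFld d T U).K × A.phiZero ((cosetGSetFunctor P).obj U)))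
    rw [key]
    exact Subgroup.zpow_mem_zpowers _ k
  exists_div₀_eq U := by
    obtain ⟨x₀, hx₀⟩ := Associates.mk_surjective (unifCls d T U)
    refine ⟨((intNonzeroToUnits (constFld d T U).K x₀, (1 : A.bZero ((cosetGSetFunctor P).obj U))) :
      ((constFld d T U).K)ˣ × A.bZero ((cosetGSetFunctor P).obj U)), const_mem_F₀ d T A hZ (op U) _, ?_⟩
    change (divisorMonoidsOf d T A hZ).div₀ (op U) _ =
      Algebra.GrothendieckGroup.of ((unifCls d T U, 1) : OrdInt (constFld d T U).K × A.phiZero ((cosetGSetFunctor P).obj U))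
    rw [divisorMonoidsOf_div₀_apply]
    dsimp only [Opposite.unop_op]
    rw [map_one, map_one, mul_one, divUnits_intNonzeroToUnits, EtaleTheta.gpMap_of, hx₀]
    rfl
  hΦinj f := divisorMonoidsOf_Φ₀_map_injective d T A hZ f.op
  hΦrefl f a b h := divisorMonoidsOf_Φ₀_map_reflects_dvd d T A hZ f.op a b h

/-- The diagonal of the data at `U` is `(unifCls U, 1)`. [cite: MochizukiEtTh2009, Def 3.6 p.77] -/
@[simp] theorem genDiagonalBase_d (hZc : Z.const = ⊥) (U : T.Dv) : (genDiagonalBase d T A hZ hZc).d U = (unifCls d T U, 1) := rfl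

/-! ## §3 The five Def. 3.6 (ii) laws at GA-04's carrier datum, and the engine-form tempered Frobenioid -/

/-- **GA-04's carrier datum IS the engine's `Φ`**: `perfSaturation(im(Φ₀(U) → Φ₀^ℝ(U))) = im(Φ₀(U)^pf → Φ₀(U)^rlf)` at every `U`
(GA-04's `perfSaturation_mrange_toR_ofRlfZWeak`), as an equality of subfunctors in monoids of `Φ^{ℝ-log}`.
[cite: MochizukiEtTh2009, Def 3.6 p.76] -/
theorem canonical_Φ_eq_Φsub (hZc : Z.const = ⊥) :
    (CarrierData.canonical (realifiedOf d T A hZ) (d := d) (T := T)).Φ =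
      (genDiagonalBase d T A hZ hZc).Φsub (isPerfFactorial_divisorMonoidsOf d T A hZ) := by
  have key : ∀ {Ψ : T.Dvᵒᵖ ⥤ CommMonCat.{0}} (S S' : SubMonoidOn Ψ), (∀ U, S.carrier U = S'.carrier U) → S = S' := by
    rintro Ψ ⟨c, m⟩ ⟨c', m'⟩ h
    obtain rfl : c = c' := funext h
    rfl
  exact key _ _ fun U => perfSaturation_mrange_toR_ofRlfZWeak _ _ U

variable [IsTopologicalGroup P]

/-- The generic Def. 3.6 (ii) engine run on the pattern data (all clauses proved there), typed over GA-03's `realifiedOf` and GA-04's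
`catVocab` (definitional unfoldings). [cite: MochizukiEtTh2009, Def 3.6 p.77] -/
private def engine (hZc : Z.const = ⊥) : TemperedFrobenioid (realifiedOf d T A hZ) T.Dv (catVocab d T) :=
  TemperedFrobenioid.ofGenDiagonalBase (isPerfFactorial_divisorMonoidsOf d T A hZ) (genDiagonalBase d T A hZ hZc)
    CosetCat.isConnected CosetCat.isTotallyEpimorphic CosetCat.isOfFSMType
    (fun (_ : T.Dvᵒᵖ ⥤ CommMonCat.{0}) => True) (fun (_ : T.Dvᵒᵖ ⥤ CommMonCat.{0}) => True)

/-- (h₁) **`Φ(U)` is group-saturated in `Φ^{ℝ-log}(U)`** at GA-04's carrier datum. [cite: MochizukiEtTh2009, Def 3.6 p.76] -/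
theorem isGroupSaturated_canonical (hZc : Z.const = ⊥) (U : T.Dvᵒᵖ) :
    IsGroupSaturated ((CarrierData.canonical (realifiedOf d T A hZ) (d := d) (T := T)).Φ.carrier U) := by
  rw [canonical_Φ_eq_Φsub d T A hZ hZc]
  exact (engine d T A hZ hZc).isGroupSaturated U

/-- (h₂) **`Φ(U)` is perf-factorial** (weak vocabulary: `IsPerfFactorialCof`) at GA-04's carrier datum. [cite: MochizukiEtTh2009, Def 3.6 p.76] -/
theorem isPerfFactorial_canonical (hZc : Z.const = ⊥) (U : T.Dvᵒᵖ) :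
    treeMonoidVocabWeak.{0}.IsPerfFactorial ((CarrierData.canonical (realifiedOf d T A hZ) (d := d) (T := T)).Φ.carrier U) := by
  rw [canonical_Φ_eq_Φsub d T A hZ hZc]
  exact (engine d T A hZ hZc).isPerfFactorial U

/-- (h₃) **`Φ` is a divisorial monoid on `𝒟_v̲`** ([FrdI] Def. 1.1 (ii): pull-backs characteristically injective, FSM-morphisms —
isomorphisms by `CosetCat.isOfFSMType` — pull back to bijections; objectwise divisorial). [cite: MochizukiEtTh2009, Def 3.6 p.77] -/
theorem isDivisorialOn_canonical (hZc : Z.const = ⊥) :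
    (catVocab d T).IsDivisorialOn (CarrierData.canonical (realifiedOf d T A hZ) (d := d) (T := T)).Φ.toFunctor := by
  rw [canonical_Φ_eq_Φsub d T A hZ hZc]
  exact (engine d T A hZ hZc).isDivisorialOn

/-- (h₄) **Def. 3.6 (ii)(a): `Φ^{bs-fld}(U) = Φ(U) ∩ ℝ·Φ₀^cnst` is monoprime** — it is `ι(⟨(unifCls U, 1)⟩^pf) ≅ ℚ≥0`. [cite: MochizukiEtTh2009, Def 3.6 p.77] -/
theorem isMonoprime_bsFld_canonical (hZc : Z.const = ⊥) (U : T.Dvᵒᵖ) :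
    IsMonoprime ↥((CarrierData.canonical (realifiedOf d T A hZ) (d := d) (T := T)).Φ.carrier U ⊓
      ((realifiedOf d T A hZ).cnstR (op ((𝟭 T.Dv).obj (unop U)))).toSubmonoid.comap Algebra.GrothendieckGroup.of) := by
  rw [canonical_Φ_eq_Φsub d T A hZ hZc]
  exact (engine d T A hZ hZc).isMonoprime_bsFld U

/-- (h₅) **Def. 3.6 (ii)(b): `F(U) → (Φ^{bs-fld})^gp(U)` is nonzero** — `div (ϖ_U, 1) = ι(d_U)/1`, `ι(d_U) ≠ 1`. [cite: MochizukiEtTh2009, Def 3.6 p.77] -/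
theorem exists_FΛ_div_ne_canonical (hZc : Z.const = ⊥) (U : T.Dvᵒᵖ) :
    ∃ b ∈ (realifiedOf d T A hZ).FΛ (op ((𝟭 T.Dv).obj (unop U))),
      ∃ x ∈ (CarrierData.canonical (realifiedOf d T A hZ) (d := d) (T := T)).Φ.carrier U,
        ∃ y ∈ (CarrierData.canonical (realifiedOf d T A hZ) (d := d) (T := T)).Φ.carrier U, x ≠ y ∧
          (realifiedOf d T A hZ).divΛ _ b = Algebra.GrothendieckGroup.of x / Algebra.GrothendieckGroup.of y := by
  rw [canonical_Φ_eq_Φsub d T A hZ hZc]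
  exact (engine d T A hZ hZc).exists_FΛ_div_ne U

/-- **[EtTh] Def. 3.6 (ii) for the arithmetic theta tower, ENGINE FORM** — the tempered Frobenioid over `𝒟_v̲ = CosetCat Π_v̲`, structure
functor `𝟭`, divisor monoid GA-04's carrier datum, ASSEMBLED BY GA-04's `CarrierData.toTemperedFrobenioid` from h₁…h₅ over GA-03's
`realifiedOf d T A hZ`; for ANY geometric log-divisor model with `Π`-action and trivial constants (the ruled `temperedFrobenioid d T` is this at
GA-10's theta envelope).  carrier: genuine-by-[EtTh]-recipe on the T-lattice (Ÿ_T, Ÿ_T × V, X̲̲_v̲ × V) + constants everywhere; off-lattice Φ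
via `rebase`/pullback; [EtTh] Def 3.3 Φ at general U and print's Ÿ̈/μ_N Kummer levels = FOUNDATIONS 13/14, not claimed; GUARD (#322): at a `T`
that is not a finite theta-tower level the carrier is print's recipe transported by (n_T, e(V|K_v̲)).  TYPED ≠ the Frobenioid of an actual
curve; no side on [IUTchIII] Cor. 3.12; NOT an abc claim. [cite: MochizukiEtTh2009, Def 3.6 p.77] -/
def temperedFrobenioidOf (hZc : Z.const = ⊥) : TemperedFrobenioid (realifiedOf d T A hZ) T.Dv (catVocab d T) :=
  (CarrierData.canonical (realifiedOf d T A hZ)).toTemperedFrobenioid (isGroupSaturated_canonical d T A hZ hZc)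
    (isPerfFactorial_canonical d T A hZ hZc) (isDivisorialOn_canonical d T A hZ hZc)
    (isMonoprime_bsFld_canonical d T A hZ hZc) (exists_FΛ_div_ne_canonical d T A hZ hZc)

/-- Its structure functor is the identity of `𝒟_v̲` (the `base_eq` clause of S0). [cite: MochizukiEtTh2009, Def 3.6 p.77] -/
theorem temperedFrobenioidOf_base (hZc : Z.const = ⊥) : (temperedFrobenioidOf d T A hZ hZc).base = 𝟭 T.Dv := rfl

/-- `Φ(U) = perfSaturation(im(Φ₀(U) → Φ₀^ℝ(U)))` (the `Φ_carrier` clause of S0, by `rfl`). [cite: MochizukiEtTh2009, Def 3.6 p.77] -/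
theorem temperedFrobenioidOf_Φ_carrier (hZc : Z.const = ⊥) (U : T.Dvᵒᵖ) :
    (temperedFrobenioidOf d T A hZ hZc).Φ.carrier U =
      perfSaturation (MonoidHom.mrange ((realifiedOf d T A hZ).toR ((temperedFrobenioidOf d T A hZ hZc).baseOp U))) := rfl

/-- Its divisor monoid IS the engine's `Φ := im(Φ₀^pf → Φ₀^rlf)` along the pattern data. [cite: MochizukiEtTh2009, Def 3.6 p.76] -/
theorem temperedFrobenioidOf_Φ_eq_Φsub (hZc : Z.const = ⊥) :
    (temperedFrobenioidOf d T A hZ hZc).Φ = (genDiagonalBase d T A hZ hZc).Φsub (isPerfFactorial_divisorMonoidsOf d T A hZ) :=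
  canonical_Φ_eq_Φsub d T A hZ hZc

/-- **Def. 3.6 (ii)(a) WITH CONTENT: `Φ^{bs-fld}(U) = ι(⟨(unifCls U, 1)⟩^pf)`** — the roots of the powers of the divisor of a
uniformiser of the constant field; a PROPER submonoid of `Φ(U)` (the geometric directions are not base-field-theoretic).
[cite: MochizukiEtTh2009, Def 3.6 p.77] -/
theorem temperedFrobenioidOf_bsFld_carrier (hZc : Z.const = ⊥) (U : T.Dvᵒᵖ) :
    (temperedFrobenioidOf d T A hZ hZc).bsFld.carrier U =
      (genDiagonalBase d T A hZ hZc).diagImage (isPerfFactorial_divisorMonoidsOf d T A hZ) U := by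
  have h := TemperedFrobenioid.ofGenDiagonalBase_bsFld_carrier (isPerfFactorial_divisorMonoidsOf d T A hZ)
    (genDiagonalBase d T A hZ hZc) CosetCat.isConnected CosetCat.isTotallyEpimorphic CosetCat.isOfFSMType
    (fun (_ : T.Dvᵒᵖ ⥤ CommMonCat.{0}) => True) (fun (_ : T.Dvᵒᵖ ⥤ CommMonCat.{0}) => True) U
  rw [← h]
  change (temperedFrobenioidOf d T A hZ hZc).Φ.carrier U ⊓ _ = (engine d T A hZ hZc).Φ.carrier U ⊓ _
  rw [temperedFrobenioidOf_Φ_eq_Φsub]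
  rfl

end GenDiag

end ArithThetaTower

end Literature.AnabelianGeometry.EtaleTheta

end
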